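/-
Copyright (c) 2026 the pub-hodgecm-mathlib formalisation cell (harness21).  Prover seat hodgecm-mathlib-R90-C10-p03 (g0) (valve hand to L1, F4 third hand),
Track B «K2-LIT» ∕ hLiu418 #184♮ = `stmt-HodgeConjecture-24832`, Road I v3, #42F′ — RULING M-158x (1) «(PIN′) ∕ HOL-½″ AT `D_V`» (LEAD F0P6-plan (g14), K2E3-typ2 (g2)
tightness finding (T-x) 23:31:59Z): the FACE-A adapters of ★ p862889 ∕ ★ p862951 RE-CUT at the rigidity domain `D_V` (the only place FACE-A applies them).
-/
import Summits.HodgeConjecture.HodgeConjecture.Theorems.K2LiuFaceAHolPrimeOfPoleSet   -- ★ p862951 (this lineage): the vocabulary + ★ p862874 `exists_continuation_of_eq_prod_singleton_mul`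
import HarnessLib

/-!
# K2_Liu road (hLiu418), Road I v3, #42F′ TOP — HOL-½″ FROM (PIN′) + (VAN′): the pole-set letters RE-CUT AT THE RIGIDITY DOMAIN `D_V` (FILE 2 of 2)

Cell `pub/hodgecm-mathlib` (D-0151), Track B.  Lane `--kind proof --supports stmt-HodgeConjecture-24832 --as helper` (count-neutral; THEOREMS ONLY: no `def`,
no `instance`, no notation, no named-fact hypothesis, no `sorry`).

WHY (K2E3-typ2 (g2) tightness finding (T-x), RULING M-158x (1)): ★ p862889's HOL-½′ and ★ p862951's (PIN) quantify over EVERY `x : piSchwartzBruhat (L⁺) (Fin (n′+n′))`,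
but FACE-A only ever applies them on the `K`-finite span `D_V = span {a ⊗ f | a ∈ V}` of a finite-dimensional `V` stable under the standard compact (the `harch` row),
and no socket-#41 lineage head reaches a non-`K`-finite `x` (the twisted Siegel–Weil family `detChar · stdExtension 𝒦 ½ (swSectionTensor … x)` is STANDARD only there:
★ `isStandardSectionFamily_swTensorTwisted … (finiteDimensional_span_orbit_of_mem_span_tmul_of_isStd … harch x.2)`).  So the payable letters are the same statements
with FACE-A's own prefix `∀ V, FiniteDimensional ℂ V → ‹harch› → ∀ x : ↥D_V` (★ ED. 6 `K2LiuFirstTermIdentityAssemblyDatumPrime` l. 111–123 BYTES VERBATIM):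
* **HOL-½″** — for anisotropic `dV′`, every `x ∈ D_V` has a continuation `Eg` of `s ↦ E^Δ(s; f_x)(h)` holomorphic on `{0 < re s}` agreeing with the series past `n/2`;
* **(PIN′)** — socket #41's five clauses with `P := {½}` LITERAL at `f_x`, for `x ∈ D_V` (supplier: the pinned TOP through the (T′) pinned transport, K2Liu-p11, and the
  standardness of `f_x` on `D_V`);
* **(VAN′)** — (VAN) («every `{½}`-cleared continuation vanishes at `½`», anisotropic `dV′`) re-cut the same way: `∀ x : ↥D_V` (the weaker letter U1-glob's B4 END
  meets; a holder of ★ p862951's unrestricted (VAN) restricts it by `fun … V _ _ x => hvan … (x : piSchwartzBruhat …)`).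
THIS FILE (2 of 2): **`hHol''_of_poleSet'_and_vanishing (hpin′ : PIN′) (hvan′ : VAN′) : HOL-½″`** — conclusion = FILE 1's `hHol″` binder bytes verbatim (same generator);
proof = ★ p862951's lines with `V hV harch x` threaded (`Eg := dslope (Es · h) ½`, ★ `exists_continuation_of_eq_prod_singleton_mul`).  Tie line for the #42F′ kit:
`hA := K2LiuFaceAHolOnSpanOfPoleSet.faceA_of_exists_continuation'' (hHol''_of_poleSet'_and_vanishing ‹PIN′› ‹VAN′›)`.
★ p862889 ∕ ★ p862951 stay true; these are the payable re-cuts.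
HONEST LABEL: HC_CM is proved only modulo the 7 printed citations (2 remaining named inputs: hLiu418 = `stmt-HodgeConjecture-24832`, h413 =
`stmt-HodgeConjecture-24833`) until rung 0 closes; adapters pay nothing by themselves — FACE-A is open until (PIN′) and (VAN) land.
References: [KudlaRallis1994] §1 Thm. 1.1; [Tan1999] §1; [Ichino2004] Thm. 1.1; [GanQiuTakeda2014] §3.6; [Liu2021] App. B Lem. B.10 (2), B.12.
-/

set_option autoImplicit false
set_option linter.dupNamespace false -- the mandated namespace repeats `HodgeConjecture.HodgeConjecture`

noncomputable section

open scoped BigOperators Matrix Topology TensorProduct SchwartzMap Classical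
open NumberField NumberField.mixedEmbedding IsDedekindDomain MeasureTheory Filter

namespace Summit.HodgeConjecture.HodgeConjecture.Cruxes.HLiu418.K2LiuHolOnSpanOfPoleSet

open Literature.NumberTheory.Automorphic Literature.NumberTheory.Automorphic.UnitaryGroup Literature.NumberTheory.GaloisRepresentations
open Literature.NumberTheory.GelbartRogawski1991 Literature.NumberTheory.GelbartRogawski1991.GRConstruction
open Literature.NumberTheory.GelbartRogawski1991.UnitaryDualPair
open Literature.NumberTheory.K2Lit.SiegelDoubled Literature.NumberTheory.K2Lit.DoubledLineTheta
open Literature.NumberTheory.Automorphic.IdeleClassGroup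
open Literature.NumberTheory.Automorphic.Liu2021
open Literature.NumberTheory.Automorphic.Liu2021.Def411WeilCarriers
open Literature.NumberTheory.Automorphic.Liu2021.Def411WeilCarriersDoubling
open Literature.NumberTheory.Weil1964
open Literature.RepresentationTheory.Liu2021
open Literature.RepresentationTheory.HarrisKudlaSweet1996 (IsSplittingChar)
open Summit.HodgeConjecture.HodgeConjecture.Cruxes.HLiu418.K2LiuFirstTermResidueFormDefs (resNorm)
open Summit.HodgeConjecture.HodgeConjecture.Cruxes.HLiu418.K2LiuResidueZeroRemovable (exists_continuation_of_eq_prod_singleton_mul)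
open Summit.HodgeConjecture.HodgeConjecture.Cruxes.HLiu418.K2LiuResidueVanishesAnisotropic (eq_zero_of_forall_resNorm_of_exists_continuation)

/-- **HOL-½″ ⟸ (PIN′) + (VAN′)**: the same with the vanishing letter ALSO re-cut at `D_V` (the weaker letter U1-glob's END head meets).
[cite: KudlaRallis1994, §1 Thm. 1.1] [cite: Liu2021, App. B Lem. B.10 (2), B.12] -/
theorem hHol''_of_poleSet'_and_vanishing
    (hpin' : ∀ (L : Type) [Field L] [NumberField L] [IsCMField L] {n : ℕ} (e : Fin 2 × Fin 1 ≃ Fin n)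
      (dV : Fin 2 → L) (hdV : ∀ i, IsCMField.complexConj L (dV i) = dV i) (hdV0 : ∀ i, dV i ≠ 0)
      (dW : Fin 1 → L) (hdW : ∀ i, IsCMField.complexConj L (dW i) = dW i) (hdW0 : ∀ i, dW i ≠ 0)
      (lam : Literature.NumberTheory.Automorphic.IdeleClassGroup L →ₜ* Circle) (hlam : IsConjugateSymplectic L lam),
      HasWeight L lam 1 →
      ∀ {M' n' : ℕ} (eW : Fin 1 × Fin 3 ≃ Fin M') (e' : Fin 2 × Fin M' ≃ Fin n')
        (dV' : Fin 3 → L) (hdV' : ∀ k, IsCMField.complexConj L (dV' k) = dV' k) (hdV'0 : ∀ k, dV' k ≠ 0)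
        (χb : HeckeCharacter L) (hχbu : χb.IsUnitary) (hχbs : Literature.RepresentationTheory.HarrisKudlaSweet1996.IsSplittingChar L 1 χb)
        (α : UnitaryGroup.adelicOne (Fp L) L (IsCMField.complexConj L) →* ℂˣ) (hα : Continuous α)
        (hαrat : ∀ u : UnitaryGroup.adelicOne (Fp L) L (IsCMField.complexConj L),
          (u : Literature.NumberTheory.GaloisRepresentations.ideleGroup L) ∈ Literature.NumberTheory.GaloisRepresentations.principalIdeles L → α u = 1)
        (_hχD : χb ^ 3 * DoubledWeilDetTwist.ratioHecke L α hα hαrat = toHeckeCharacter L lam⁻¹)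
        (𝒦 : IwasawaDatum L e dV hdV dW hdW) (_h𝒦 : 𝒦.IsStd),
        (¬ ∃ v : Fin 3 → L, v ≠ 0 ∧ ∑ k, dV' k * (v k * IsCMField.complexConj L (v k)) = 0) →
        ∀ (V : Submodule ℂ 𝓢(((Fin (n' + n')) → mixedSpace (Fp L)), ℂ)), FiniteDimensional ℂ V →
          (∀ ainf : UnitaryGroup.arch (Fp L) L (IsCMField.complexConj L) (n + n) (hermD L e dV hdV dW hdW),
            (UnitaryGroup.archToAdelic (Fp L) L (IsCMField.complexConj L) (n + n) (hermD L e dV hdV dW hdW) ainf : HA L e dV hdV dW hdW) ∈ 𝒦.K →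
            ∀ a ∈ V, ∃ a'' ∈ V, ∀ f : FinSB (Fp L) (Fin (n' + n')),
              adelicMpCont.omega (Fp L) (Fin (n' + n')) (gramDA L e' dV hdV (tensorFrame L dW eW dV') (tensorFrame_real L dW hdW eW dV' hdV'))
                  ((doubledWeilRep L e' dV hdV hdV0 (tensorFrame L dW eW dV') (tensorFrame_real L dW hdW eW dV' hdV')
                        (tensorFrame_ne_zero L dW eW dV' hdW0 hdV'0) χb hχbu hχbs)
                    (tensorEmb L e dV hdV dW hdW eW e' dV' hdV'
                      (UnitaryGroup.archToAdelic (Fp L) L (IsCMField.complexConj L) (n + n) (hermD L e dV hdV dW hdW) ainf)))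
                  (piSchwartzBruhatEquiv (Fp L) (Fin (n' + n')) (a ⊗ₜ[ℂ] f)) =
                piSchwartzBruhatEquiv (Fp L) (Fin (n' + n')) (a'' ⊗ₜ[ℂ] f)) →
          ∀ (x : ↥(Submodule.span ℂ {x : piSchwartzBruhat (Fp L) (Fin (n' + n')) |
              ∃ a ∈ V, ∃ f : FinSB (Fp L) (Fin (n' + n')), x = piSchwartzBruhatEquiv (Fp L) (Fin (n' + n')) (a ⊗ₜ[ℂ] f)})), ∃ Es : ℂ → HA L e dV hdV dW hdW → ℂ,
            (∀ h : HA L e dV hdV dW hdW, DifferentiableOn ℂ (fun s => Es s h) {s : ℂ | 0 < s.re}) ∧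
            (∀ s : ℂ, 0 < s.re → Continuous (Es s)) ∧
            (∀ s : ℂ, 0 < s.re → ∀ (γ : ratH L e dV hdV dW hdW) (h : HA L e dV hdV dW hdW),
              Es s ((γ : HA L e dV hdV dW hdW) * h) = Es s h) ∧
            (∀ (s : ℂ) (h : HA L e dV hdV dW hdW), (n : ℝ) / 2 < s.re →
              Es s h = (∏ p ∈ ({(1 / 2 : ℂ)} : Finset ℂ), (s - p)) * eisensteinFamilyDelta L e dV hdV dW hdW
              (fun s₁ h₁ => ((DoubledWeilDetTwist.detChar L e dV hdV hdV0 dW hdW hdW0 α h₁ : ℂˣ) : ℂ) *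
                stdExtension 𝒦 ((((3 : ℕ) : ℂ) - (n : ℂ)) / 2)
                  (swSectionTensor L e dV hdV dW hdW eW e' dV' hdV' hdV0 hdW0 hdV'0
                    (doubledWeilRep L e' dV hdV hdV0 (tensorFrame L dW eW dV') (tensorFrame_real L dW hdW eW dV' hdV')
                      (tensorFrame_ne_zero L dW eW dV' hdW0 hdV'0) χb hχbu hχbs)
                    (x : piSchwartzBruhat (Fp L) (Fin (n' + n')))) s₁ h₁) s h) ∧
            (∀ z : ℂ, 0 < z.re → ∃ C A r : ℝ, 0 < r ∧ ∀ s : ℂ, dist s z < r → ∀ h : HA L e dV hdV dW hdW,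
              ‖Es s h‖ ≤ C * adelicHeightGL (n + n) L (h : GL (Fin (n + n)) (AdeleRing (𝓞 L) L)) ^ A))
    (hvan' : ∀ (L : Type) [Field L] [NumberField L] [IsCMField L] {n : ℕ} (e : Fin 2 × Fin 1 ≃ Fin n)
      (dV : Fin 2 → L) (hdV : ∀ i, IsCMField.complexConj L (dV i) = dV i) (hdV0 : ∀ i, dV i ≠ 0)
      (dW : Fin 1 → L) (hdW : ∀ i, IsCMField.complexConj L (dW i) = dW i) (hdW0 : ∀ i, dW i ≠ 0)
      (lam : Literature.NumberTheory.Automorphic.IdeleClassGroup L →ₜ* Circle) (hlam : IsConjugateSymplectic L lam),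
      HasWeight L lam 1 →
      ∀ {M' n' : ℕ} (eW : Fin 1 × Fin 3 ≃ Fin M') (e' : Fin 2 × Fin M' ≃ Fin n')
        (dV' : Fin 3 → L) (hdV' : ∀ k, IsCMField.complexConj L (dV' k) = dV' k) (hdV'0 : ∀ k, dV' k ≠ 0)
        (χb : HeckeCharacter L) (hχbu : χb.IsUnitary) (hχbs : Literature.RepresentationTheory.HarrisKudlaSweet1996.IsSplittingChar L 1 χb)
        (α : UnitaryGroup.adelicOne (Fp L) L (IsCMField.complexConj L) →* ℂˣ) (hα : Continuous α)
        (hαrat : ∀ u : UnitaryGroup.adelicOne (Fp L) L (IsCMField.complexConj L),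
          (u : Literature.NumberTheory.GaloisRepresentations.ideleGroup L) ∈ Literature.NumberTheory.GaloisRepresentations.principalIdeles L → α u = 1)
        (_hχD : χb ^ 3 * DoubledWeilDetTwist.ratioHecke L α hα hαrat = toHeckeCharacter L lam⁻¹)
        (𝒦 : IwasawaDatum L e dV hdV dW hdW) (_h𝒦 : 𝒦.IsStd),
        -- (VAN′): (VAN) on the rigidity domain `D_V` only
        (¬ ∃ v : Fin 3 → L, v ≠ 0 ∧ ∑ k, dV' k * (v k * IsCMField.complexConj L (v k)) = 0) →
        ∀ (V : Submodule ℂ 𝓢(((Fin (n' + n')) → mixedSpace (Fp L)), ℂ)), FiniteDimensional ℂ V →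
          (∀ ainf : UnitaryGroup.arch (Fp L) L (IsCMField.complexConj L) (n + n) (hermD L e dV hdV dW hdW),
            (UnitaryGroup.archToAdelic (Fp L) L (IsCMField.complexConj L) (n + n) (hermD L e dV hdV dW hdW) ainf : HA L e dV hdV dW hdW) ∈ 𝒦.K →
            ∀ a ∈ V, ∃ a'' ∈ V, ∀ f : FinSB (Fp L) (Fin (n' + n')),
              adelicMpCont.omega (Fp L) (Fin (n' + n')) (gramDA L e' dV hdV (tensorFrame L dW eW dV') (tensorFrame_real L dW hdW eW dV' hdV'))
                  ((doubledWeilRep L e' dV hdV hdV0 (tensorFrame L dW eW dV') (tensorFrame_real L dW hdW eW dV' hdV')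
                        (tensorFrame_ne_zero L dW eW dV' hdW0 hdV'0) χb hχbu hχbs)
                    (tensorEmb L e dV hdV dW hdW eW e' dV' hdV'
                      (UnitaryGroup.archToAdelic (Fp L) L (IsCMField.complexConj L) (n + n) (hermD L e dV hdV dW hdW) ainf)))
                  (piSchwartzBruhatEquiv (Fp L) (Fin (n' + n')) (a ⊗ₜ[ℂ] f)) =
                piSchwartzBruhatEquiv (Fp L) (Fin (n' + n')) (a'' ⊗ₜ[ℂ] f)) →
          ∀ (x : ↥(Submodule.span ℂ {x : piSchwartzBruhat (Fp L) (Fin (n' + n')) |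
              ∃ a ∈ V, ∃ f : FinSB (Fp L) (Fin (n' + n')), x = piSchwartzBruhatEquiv (Fp L) (Fin (n' + n')) (a ⊗ₜ[ℂ] f)})) (Es : ℂ → HA L e dV hdV dW hdW → ℂ),
            (∀ h : HA L e dV hdV dW hdW, DifferentiableOn ℂ (fun s => Es s h) {s : ℂ | 0 < s.re}) →
            (∀ (s : ℂ) (h : HA L e dV hdV dW hdW), (n : ℝ) / 2 < s.re →
              Es s h = (∏ p ∈ ({(1 / 2 : ℂ)} : Finset ℂ), (s - p)) * eisensteinFamilyDelta L e dV hdV dW hdW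
              (fun s₁ h₁ => ((DoubledWeilDetTwist.detChar L e dV hdV hdV0 dW hdW hdW0 α h₁ : ℂˣ) : ℂ) *
                stdExtension 𝒦 ((((3 : ℕ) : ℂ) - (n : ℂ)) / 2)
                  (swSectionTensor L e dV hdV dW hdW eW e' dV' hdV' hdV0 hdW0 hdV'0
                    (doubledWeilRep L e' dV hdV hdV0 (tensorFrame L dW eW dV') (tensorFrame_real L dW hdW eW dV' hdV')
                      (tensorFrame_ne_zero L dW eW dV' hdW0 hdV'0) χb hχbu hχbs)
                    (x : piSchwartzBruhat (Fp L) (Fin (n' + n')))) s₁ h₁) s h) →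
            ∀ h : HA L e dV hdV dW hdW, Es (1 / 2) h = 0) :
    ∀ (L : Type) [Field L] [NumberField L] [IsCMField L] {n : ℕ} (e : Fin 2 × Fin 1 ≃ Fin n)
      (dV : Fin 2 → L) (hdV : ∀ i, IsCMField.complexConj L (dV i) = dV i) (hdV0 : ∀ i, dV i ≠ 0)
      (dW : Fin 1 → L) (hdW : ∀ i, IsCMField.complexConj L (dW i) = dW i) (hdW0 : ∀ i, dW i ≠ 0)
      (lam : Literature.NumberTheory.Automorphic.IdeleClassGroup L →ₜ* Circle) (hlam : IsConjugateSymplectic L lam),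
      HasWeight L lam 1 →
      ∀ {M' n' : ℕ} (eW : Fin 1 × Fin 3 ≃ Fin M') (e' : Fin 2 × Fin M' ≃ Fin n')
        (dV' : Fin 3 → L) (hdV' : ∀ k, IsCMField.complexConj L (dV' k) = dV' k) (hdV'0 : ∀ k, dV' k ≠ 0)
        (χb : HeckeCharacter L) (hχbu : χb.IsUnitary) (hχbs : Literature.RepresentationTheory.HarrisKudlaSweet1996.IsSplittingChar L 1 χb)
        (α : UnitaryGroup.adelicOne (Fp L) L (IsCMField.complexConj L) →* ℂˣ) (hα : Continuous α)
        (hαrat : ∀ u : UnitaryGroup.adelicOne (Fp L) L (IsCMField.complexConj L),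
          (u : Literature.NumberTheory.GaloisRepresentations.ideleGroup L) ∈ Literature.NumberTheory.GaloisRepresentations.principalIdeles L → α u = 1)
        (_hχD : χb ^ 3 * DoubledWeilDetTwist.ratioHecke L α hα hαrat = toHeckeCharacter L lam⁻¹)
        (𝒦 : IwasawaDatum L e dV hdV dW hdW) (_h𝒦 : 𝒦.IsStd),
        (¬ ∃ v : Fin 3 → L, v ≠ 0 ∧ ∑ k, dV' k * (v k * IsCMField.complexConj L (v k)) = 0) →
        ∀ (V : Submodule ℂ 𝓢(((Fin (n' + n')) → mixedSpace (Fp L)), ℂ)), FiniteDimensional ℂ V →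
          (∀ ainf : UnitaryGroup.arch (Fp L) L (IsCMField.complexConj L) (n + n) (hermD L e dV hdV dW hdW),
            (UnitaryGroup.archToAdelic (Fp L) L (IsCMField.complexConj L) (n + n) (hermD L e dV hdV dW hdW) ainf : HA L e dV hdV dW hdW) ∈ 𝒦.K →
            ∀ a ∈ V, ∃ a'' ∈ V, ∀ f : FinSB (Fp L) (Fin (n' + n')),
              adelicMpCont.omega (Fp L) (Fin (n' + n')) (gramDA L e' dV hdV (tensorFrame L dW eW dV') (tensorFrame_real L dW hdW eW dV' hdV'))
                  ((doubledWeilRep L e' dV hdV hdV0 (tensorFrame L dW eW dV') (tensorFrame_real L dW hdW eW dV' hdV')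
                        (tensorFrame_ne_zero L dW eW dV' hdW0 hdV'0) χb hχbu hχbs)
                    (tensorEmb L e dV hdV dW hdW eW e' dV' hdV'
                      (UnitaryGroup.archToAdelic (Fp L) L (IsCMField.complexConj L) (n + n) (hermD L e dV hdV dW hdW) ainf)))
                  (piSchwartzBruhatEquiv (Fp L) (Fin (n' + n')) (a ⊗ₜ[ℂ] f)) =
                piSchwartzBruhatEquiv (Fp L) (Fin (n' + n')) (a'' ⊗ₜ[ℂ] f)) →
          ∀ (x : ↥(Submodule.span ℂ {x : piSchwartzBruhat (Fp L) (Fin (n' + n')) |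
              ∃ a ∈ V, ∃ f : FinSB (Fp L) (Fin (n' + n')), x = piSchwartzBruhatEquiv (Fp L) (Fin (n' + n')) (a ⊗ₜ[ℂ] f)})), ∃ Eg : ℂ → HA L e dV hdV dW hdW → ℂ,
            (∀ h : HA L e dV hdV dW hdW, DifferentiableOn ℂ (fun s => Eg s h) {s : ℂ | 0 < s.re}) ∧
            ∀ (s : ℂ) (h : HA L e dV hdV dW hdW), (n : ℝ) / 2 < s.re →
              Eg s h = eisensteinFamilyDelta L e dV hdV dW hdW
              (fun s₁ h₁ => ((DoubledWeilDetTwist.detChar L e dV hdV hdV0 dW hdW hdW0 α h₁ : ℂˣ) : ℂ) *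
                stdExtension 𝒦 ((((3 : ℕ) : ℂ) - (n : ℂ)) / 2)
                  (swSectionTensor L e dV hdV dW hdW eW e' dV' hdV' hdV0 hdW0 hdV'0
                    (doubledWeilRep L e' dV hdV hdV0 (tensorFrame L dW eW dV') (tensorFrame_real L dW hdW eW dV' hdV')
                      (tensorFrame_ne_zero L dW eW dV' hdW0 hdV'0) χb hχbu hχbs)
                    (x : piSchwartzBruhat (Fp L) (Fin (n' + n')))) s₁ h₁) s h := by
  intro L _ _ _ n e dV hdV hdV0 dW hdW hdW0 lam hlam hwt M' n' eW e' dV' hdV' hdV'0 χb hχbu hχbs α hα hαrat hχD 𝒦 h𝒦 hiso V hV harch x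
  have hn : 0 < n := by
    have h2 : Fintype.card (Fin 2 × Fin 1) = Fintype.card (Fin n) := Fintype.card_congr e
    simp only [Fintype.card_prod, Fintype.card_fin] at h2
    omega
  obtain ⟨Es, hd, -, -, heq, -⟩ := hpin' L e dV hdV hdV0 dW hdW hdW0 lam hlam hwt eW e' dV' hdV' hdV'0 χb hχbu hχbs α hα hαrat hχD 𝒦 h𝒦 hiso V hV harch x
  exact exists_continuation_of_eq_prod_singleton_mul hn _ Es hd (hvan' L e dV hdV hdV0 dW hdW hdW0 lam hlam hwt eW e' dV' hdV' hdV'0 χb hχbu hχbs α hα hαrat hχD 𝒦 h𝒦 hiso V hV harch x Es hd heq) heq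

end Summit.HodgeConjecture.HodgeConjecture.Cruxes.HLiu418.K2LiuHolOnSpanOfPoleSet

end
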